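import Summits.AtomisticToContinuum.BoseEinsteinCondensation.Theorems.BoxCountShadowCellFloor
import HarnessLib

/-!
# BoxCountShadowCellProfile — the coercive cell profile at the horizon scale (S2b of the CoercivityLine)

Assembly of the per-cell floors of `BoxCountShadowCellFloor` into the count-vector profile.
Main result `cellProfile_holds η`: for `ρ < ρ₀(v, M, e)`, all `n`, all `K` in the window `InWindow (Mρ^{-η}) ρ L K`
and all count vectors `m ∈ ℕ^{K³}` with `Σ m = n+1`,
`4πρa(1−e)(n+1)·(1 + w_K(m)) ≤ Σ_B E₀^N(m_B, L/K) + 4πρa·e·(n+1)`, `w_K(m) = Σ_B K⁻³ min((m_B/λ − 1)², 1)`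
(choices: `e' = min e 1 / 2`, `x_lo = ρ^{1/16}/(4πa³/3)` so `Y_lo = ρ^{17/16}`, box condition via `ρ^{-3/8} = ρ^{1/8}/√ρ`,
`λ = ρℓ³ ≥ 1` via `√ρ ≤ M³`).  This is stub S2 `CellProfile η` of the COERC_h skeleton (node g36 «DensityCoercivity»),
now a theorem for every `η ≥ 0`.  No instances, no notation, no sorry.
-/

noncomputable section

open MeasureTheory Filter Set Topology
open scoped ENNReal NNReal BigOperators

namespace Summit.AtomisticToContinuum.BoseEinsteinCondensation.Theorems.BoxCountShadow

open Literature.MathematicalPhysics.QuantumManyBody.BoseGas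
open Summit.AtomisticToContinuum.BoseEinsteinCondensation.Theorems.BoxLatticeFSum
open Summit.AtomisticToContinuum.BoseEinsteinCondensation.Theorems.BoxLabelAffinity
open Summit.AtomisticToContinuum.BoseEinsteinCondensation.Theorems.BoxHorizonAffinity

/-! ### The cell profile -/

set_option maxHeartbeats 800000 in
/-- **The coercive cell profile at the horizon scale** (stub S2 `CellProfile η` of the COERC_h skeleton, for every
`η ≥ 0`): for `ρ < ρ₀(v, M, e)`, all `n`, all `K ≥ 1` with `Mρ^{-η}/√ρ ≤ L/K ≤ 2Mρ^{-η}/√ρ` and all `m ∈ ℕ^{K³}` with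
`Σ m = n+1`, `4πρa(1−e)(n+1)(1 + w_K(m)) ≤ Σ_B E₀^N(m_B, L/K) + 4πρa·e·(n+1)`.
[cite: LSSY2005, Thm. 2.4 (2.35), (2.53)] -/
theorem cellProfile_holds (η : ℝ≥0) :
    ∀ v : ℝ → ℝ≥0∞, IsRepulsiveFiniteRange v → 0 < scatteringLength v → ∀ M : ℝ, 0 < M →
    ∀ e : ℝ, 0 < e → ∃ ρ₀ : ℝ, 0 < ρ₀ ∧ ∀ ρ : ℝ, 0 < ρ → ρ < ρ₀ → ∀ n : ℕ, ∀ K : ℕ, 0 < K →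
      InWindow (M * ρ ^ (-(η : ℝ))) ρ (sideLength ρ (n + 1)) K →
      ∀ m : SubIdx K → ℕ, ∑ B, m B = n + 1 →
        ENNReal.ofReal (4 * Real.pi * ρ * (scatteringLength v).toReal * (1 - e) * ((n + 1 : ℕ) : ℝ)) *
            (1 + truncWeight K (((n + 1 : ℕ) : ℝ) / (K : ℝ) ^ 3) m) ≤
          (∑ B : SubIdx K, neumannGroundStateEnergy v (m B) (sideLength ρ (n + 1) / (K : ℝ))) +
            ENNReal.ofReal (4 * Real.pi * ρ * (scatteringLength v).toReal * e * ((n + 1 : ℕ) : ℝ)) := by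
  intro v hv hapos M hM e he
  have hatop : scatteringLength v ≠ ⊤ := hv.scatteringLength_ne_top
  obtain ⟨δ, C, C', hδ, hC, hC', H⟩ := LSSY2005_lowerBound_neumann_holds v hv hatop
  set a : ℝ := (scatteringLength v).toReal with hadef
  have ha : 0 < a := ENNReal.toReal_pos hapos.ne' hatop
  -- the error budget `e' = min(e,1)/2`: `err ≤ e'`, `x_lo² ≤ e'`
  set e' : ℝ := min e 1 / 2 with he'def
  have hmin : 0 < min e 1 := lt_min he one_pos
  have he' : 0 < e' := by positivity
  have he'e : e' ≤ e / 2 := by have := min_le_left e 1; rw [he'def]; linarith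
  have he'1 : e' ≤ 1 := by have := min_le_right e 1; rw [he'def]; linarith
  obtain ⟨ρ₀, hρ₀, hP⟩ := cellProfileParams_eventually a C C' hM hδ he'
  refine ⟨ρ₀, hρ₀, fun ρ hρ hρρ₀ n K hK hwin m hmsum => ?_⟩
  obtain ⟨hρ1, hsqrtM, hδ9, herr, hboxρ, hxlo2⟩ := hP ρ hρ hρρ₀
  -- scales: `L`, `ℓ = L/K`, `λ = (n+1)/K³ = ρℓ³ ≥ 1`
  have hN : 0 < n + 1 := Nat.succ_pos n
  have hNr : (0 : ℝ) < ((n + 1 : ℕ) : ℝ) := Nat.cast_pos.2 hN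
  set L : ℝ := sideLength ρ (n + 1) with hLdef
  have hL : 0 < L := Real.rpow_pos_of_pos (div_pos hNr hρ) _
  have hKr : (0 : ℝ) < K := Nat.cast_pos.2 hK
  set ℓ : ℝ := L / (K : ℝ) with hℓdef
  have hℓ : 0 < ℓ := div_pos hL hKr
  set lam : ℝ := ((n + 1 : ℕ) : ℝ) / (K : ℝ) ^ 3 with hlamdef
  have hlam : 0 < lam := by positivity
  have hρL : ((n + 1 : ℕ) : ℝ) / L ^ 3 = ρ := div_sideLength_pow_three hρ hN
  have hL3 : L ^ 3 = ((n + 1 : ℕ) : ℝ) / ρ := by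
    rw [← hρL]; field_simp
  have hlamℓ : lam = ρ * ℓ ^ 3 := by
    rw [hlamdef, hℓdef, div_pow, hL3]; field_simp
  have hlamK : lam * (K : ℝ) ^ 3 = ((n + 1 : ℕ) : ℝ) := by
    rw [hlamdef]; field_simp
  have hsqrt : 0 < Real.sqrt ρ := Real.sqrt_pos.2 hρ
  have hρη : 1 ≤ ρ ^ (-(η : ℝ)) :=
    Real.one_le_rpow_of_pos_of_le_one_of_nonpos hρ hρ1.le (neg_nonpos.2 η.coe_nonneg)
  have hℓM : M / Real.sqrt ρ ≤ ℓ := by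
    have h1 : M * ρ ^ (-(η : ℝ)) / Real.sqrt ρ ≤ L / (K : ℝ) := hwin.1
    calc M / Real.sqrt ρ ≤ M * ρ ^ (-(η : ℝ)) / Real.sqrt ρ := by
          gcongr; exact le_mul_of_one_le_right hM.le hρη
      _ ≤ ℓ := h1
  have hlam1 : 1 ≤ lam := by
    have hs3 : Real.sqrt ρ ^ 3 = ρ * Real.sqrt ρ := by
      rw [pow_succ, Real.sq_sqrt hρ.le]
    have hM3 : ρ * (M / Real.sqrt ρ) ^ 3 = M ^ 3 / Real.sqrt ρ := by
      rw [div_pow, hs3]; field_simp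
    have hMs : 0 ≤ M / Real.sqrt ρ := by positivity
    calc (1 : ℝ) ≤ M ^ 3 / Real.sqrt ρ := by rw [le_div_iff₀ hsqrt, one_mul]; exact hsqrtM
      _ = ρ * (M / Real.sqrt ρ) ^ 3 := hM3.symm
      _ ≤ ρ * ℓ ^ 3 := by gcongr
      _ = lam := hlamℓ.symm
  -- Theorem 2.4 and superadditivity in a cell of side `ℓ`
  have hT : ∀ m : ℕ, 4 * Real.pi * ((m : ℝ) / ℓ ^ 3) * a ^ 3 / 3 < δ →
      C' * (4 * Real.pi * ((m : ℝ) / ℓ ^ 3) * a ^ 3 / 3) ^ (-(6 : ℝ) / 17) < ℓ / a →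
      ENNReal.ofReal (4 * Real.pi * ((m : ℝ) / ℓ ^ 3) * a *
          (1 - C * (4 * Real.pi * ((m : ℝ) / ℓ ^ 3) * a ^ 3 / 3) ^ ((1 : ℝ) / 17)) * m) ≤
        neumannGroundStateEnergy v m ℓ :=
    fun m h1 h2 => H m ℓ hℓ h1 h2
  have hSA : ∀ p q r : ℕ, (q : ℝ≥0∞) * neumannGroundStateEnergy v p ℓ ≤
      neumannGroundStateEnergy v (q * p + r) ℓ :=
    fun p q r => LSSY2005_superadditivity_holds.mul_le hv.1 hℓ p q r
  -- the filling threshold `x_lo = ρ^{1/16}/(4πa³/3)`, i.e. `Y_lo = ρ^{17/16}`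
  set xlo : ℝ := ρ ^ ((1 : ℝ) / 16) / (4 * Real.pi * a ^ 3 / 3) with hxlodef
  have hxlo : 0 < xlo := by positivity
  have hxlo1 : xlo ≤ 1 := by nlinarith [he'1]
  have hYlo : 4 * Real.pi * (xlo * ρ) * a ^ 3 / 3 = ρ ^ ((17 : ℝ) / 16) := by
    have h17 : ρ ^ ((17 : ℝ) / 16) = ρ ^ ((1 : ℝ) / 16) * ρ := by
      rw [show (17 : ℝ) / 16 = (1 : ℝ) / 16 + 1 by norm_num, Real.rpow_add hρ, Real.rpow_one]
    rw [h17, hxlodef]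
    field_simp
  have hbox : C' * (4 * Real.pi * (xlo * ρ) * a ^ 3 / 3) ^ (-(6 : ℝ) / 17) < ℓ / a := by
    rw [hYlo, ← Real.rpow_mul hρ.le, show (17 : ℝ) / 16 * (-(6 : ℝ) / 17) = (1 : ℝ) / 8 - 1 / 2 by norm_num,
      Real.rpow_sub hρ, ← Real.sqrt_eq_rpow]
    calc C' * (ρ ^ ((1 : ℝ) / 8) / Real.sqrt ρ) = C' * a * ρ ^ ((1 : ℝ) / 8) / (a * Real.sqrt ρ) := by
          field_simp
      _ < M / (a * Real.sqrt ρ) := div_lt_div_of_pos_right hboxρ (by positivity)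
      _ = M / Real.sqrt ρ / a := by rw [div_div, mul_comm]
      _ ≤ ℓ / a := div_le_div_of_nonneg_right hℓM ha.le
  -- per-cell bounds in gauge form, summed over the cells
  have hu0 : 0 ≤ 4 * Real.pi * a * ρ * lam * (1 - e') := by
    have : 0 ≤ 1 - e' := by linarith
    positivity
  have hcell : ∀ B : SubIdx K,
      ENNReal.ofReal (4 * Real.pi * a * ρ * lam * (1 - e') * cellGauge (((m B : ℕ) : ℝ) / lam)) ≤
        neumannGroundStateEnergy v (m B) ℓ + ENNReal.ofReal (4 * Real.pi * a * ρ * lam * (1 - e') * xlo ^ 2) :=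
    fun B => cell_lowerBound_gauge ha hℓ hlam hρ hlamℓ hC hC' hxlo hT hSA hδ9 herr he'1 hbox hlam1 hxlo1 (m B)
  have hcard : ((Finset.univ : Finset (SubIdx K)).card : ℝ) = (K : ℝ) ^ 3 := by
    rw [Finset.card_univ, show Fintype.card (SubIdx K) = K ^ 3 by simp]; push_cast; ring
  -- the relative fillings and the real weight
  set x : SubIdx K → ℝ := fun B => ((m B : ℕ) : ℝ) / lam with hxdef
  have hx0 : ∀ B, 0 ≤ x B := fun B => by positivity
  have hxsum : ∑ B, x B = (K : ℝ) ^ 3 := by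
    simp only [hxdef]
    rw [← Finset.sum_div]
    have : (∑ B, ((m B : ℕ) : ℝ)) = ((n + 1 : ℕ) : ℝ) := by exact_mod_cast hmsum
    rw [this, div_eq_iff hlam.ne', ← hlamK, mul_comm]
  set w : ℝ := ∑ B, (1 / (K : ℝ)) ^ 3 * min ((x B - 1) ^ 2) 1 with hwdef
  have hw0 : 0 ≤ w := Finset.sum_nonneg fun B _ => by positivity
  have htw : truncWeight K (((n + 1 : ℕ) : ℝ) / (K : ℝ) ^ 3) m = ENNReal.ofReal w := by
    rw [truncWeight_eq_ofReal]
  have hgauge : (K : ℝ) ^ 3 * (1 + w) ≤ ∑ B, cellGauge (x B) := sum_cellGauge_ge hK x hx0 hxsum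
  -- (I): `A(1−e')(1+w) ≤ Σ_B E₀ + A(1−e') x_lo²`, `A = 4πρa(n+1)`
  set A : ℝ := 4 * Real.pi * ρ * a * ((n + 1 : ℕ) : ℝ) with hAdef
  have hA0 : 0 < A := by positivity
  set S : ℝ≥0∞ := ∑ B : SubIdx K, neumannGroundStateEnergy v (m B) ℓ with hSdef
  have huA : 4 * Real.pi * a * ρ * lam * (1 - e') * ((K : ℝ) ^ 3 * (1 + w)) = A * (1 - e') * (1 + w) := by
    rw [hAdef, ← hlamK]; ring
  have huA' : ((Finset.univ : Finset (SubIdx K)).card : ℝ) * (4 * Real.pi * a * ρ * lam * (1 - e') * xlo ^ 2) =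
      A * (1 - e') * xlo ^ 2 := by
    rw [hcard, hAdef, ← hlamK]; ring
  have hI : ENNReal.ofReal (A * (1 - e') * (1 + w)) ≤ S + ENNReal.ofReal (A * (1 - e') * xlo ^ 2) := by
    calc ENNReal.ofReal (A * (1 - e') * (1 + w))
        = ENNReal.ofReal (4 * Real.pi * a * ρ * lam * (1 - e') * ((K : ℝ) ^ 3 * (1 + w))) := by rw [huA]
      _ ≤ ENNReal.ofReal (4 * Real.pi * a * ρ * lam * (1 - e') * ∑ B, cellGauge (x B)) :=
          ENNReal.ofReal_le_ofReal (mul_le_mul_of_nonneg_left hgauge hu0)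
      _ = ∑ B, ENNReal.ofReal (4 * Real.pi * a * ρ * lam * (1 - e') * cellGauge (x B)) := by
          rw [Finset.mul_sum, ENNReal.ofReal_sum_of_nonneg]
          exact fun B _ => mul_nonneg hu0 (cellGauge_nonneg (hx0 B))
      _ ≤ ∑ B, (neumannGroundStateEnergy v (m B) ℓ +
            ENNReal.ofReal (4 * Real.pi * a * ρ * lam * (1 - e') * xlo ^ 2)) :=
          Finset.sum_le_sum fun B _ => hcell B
      _ = S + ENNReal.ofReal (A * (1 - e') * xlo ^ 2) := by
          rw [Finset.sum_add_distrib, Finset.sum_const, nsmul_eq_mul, ← ENNReal.ofReal_natCast,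
            ← ENNReal.ofReal_mul (by positivity), huA']
  -- (II): the budget `(1−e')x_lo² ≤ (e−e')(1+w) + e`
  by_cases he1 : 1 < e
  · have h0 : 4 * Real.pi * ρ * a * (1 - e) * ((n + 1 : ℕ) : ℝ) ≤ 0 := by
      rw [show 4 * Real.pi * ρ * a * (1 - e) * ((n + 1 : ℕ) : ℝ) = A * (1 - e) by rw [hAdef]; ring]
      exact mul_nonpos_of_nonneg_of_nonpos hA0.le (by linarith)
    rw [ENNReal.ofReal_of_nonpos h0, zero_mul]
    exact bot_le
  push Not at he1
  have hX : ENNReal.ofReal (A * (1 - e') * xlo ^ 2) ≠ ⊤ := ENNReal.ofReal_ne_top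
  have hR : A * (1 - e) * (1 + w) + A * (1 - e') * xlo ^ 2 ≤ A * (1 - e') * (1 + w) + A * e := by
    have hb : (1 - e) * (1 + w) + (1 - e') * xlo ^ 2 ≤ (1 - e') * (1 + w) + e := by
      nlinarith [mul_nonneg he'.le (sq_nonneg xlo), mul_nonneg (by linarith : 0 ≤ e - e') hw0, sq_nonneg xlo]
    nlinarith [mul_le_mul_of_nonneg_left hb hA0.le]
  have hLHS : ENNReal.ofReal (4 * Real.pi * ρ * a * (1 - e) * ((n + 1 : ℕ) : ℝ)) *
      (1 + truncWeight K (((n + 1 : ℕ) : ℝ) / (K : ℝ) ^ 3) m) = ENNReal.ofReal (A * (1 - e) * (1 + w)) := by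
    rw [htw, ← ENNReal.ofReal_one, ← ENNReal.ofReal_add zero_le_one hw0, ← ENNReal.ofReal_mul']
    · congr 1; rw [hAdef]; ring
    · linarith
  have hRHS : ENNReal.ofReal (4 * Real.pi * ρ * a * e * ((n + 1 : ℕ) : ℝ)) =
      ENNReal.ofReal (A * e) := by
    congr 1; rw [hAdef]; ring
  rw [hLHS, hRHS, ← ENNReal.add_le_add_iff_right hX]
  have h1e : 0 ≤ A * (1 - e) * (1 + w) := by
    have : 0 ≤ 1 - e := by linarith
    positivity
  have h1e' : 0 ≤ A * (1 - e') * (1 + w) := by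
    have : 0 ≤ 1 - e' := by linarith
    positivity
  calc ENNReal.ofReal (A * (1 - e) * (1 + w)) + ENNReal.ofReal (A * (1 - e') * xlo ^ 2)
      = ENNReal.ofReal (A * (1 - e) * (1 + w) + A * (1 - e') * xlo ^ 2) :=
        (ENNReal.ofReal_add h1e (by positivity)).symm
    _ ≤ ENNReal.ofReal (A * (1 - e') * (1 + w) + A * e) := ENNReal.ofReal_le_ofReal hR
    _ = ENNReal.ofReal (A * (1 - e') * (1 + w)) + ENNReal.ofReal (A * e) :=
        ENNReal.ofReal_add h1e' (by positivity)
    _ ≤ (S + ENNReal.ofReal (A * (1 - e') * xlo ^ 2)) + ENNReal.ofReal (A * e) := by gcongr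
    _ = S + ENNReal.ofReal (A * e) + ENNReal.ofReal (A * (1 - e') * xlo ^ 2) := by ring

end Summit.AtomisticToContinuum.BoseEinsteinCondensation.Theorems.BoxCountShadow

end
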